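import Mathlib.NumberTheory.Padics.PadicIntegers
import Mathlib.NumberTheory.Padics.ProperSpace
import Mathlib.Topology.MetricSpace.Ultra.TotallySeparated
import Mathlib.Analysis.Normed.Ring.Units
import Mathlib.Topology.Algebra.Group.Basic
import Mathlib.Topology.Homeomorph.Defs
import Mathlib.GroupTheory.Index
import HarnessLib

/-!
# A concrete slim pro-`p` group with two mutually estranged malnormal procyclic subgroups

Witness material for the abc-iut cell (layer L3, row WIT-1b of abc-iut-L3-lead: non-vacuity of the
hypothesis bundles of [SemiAnbd] §3 WITH AN EDGE — Mochizuki, *Semi-graphs of anabelioids*, Publ. RIMS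
**42** (2006), Def. 2.4 (iv) p. 26 "aloof / estranged", Def. 2.4 (ii) "verticially slim"). Pure group
theory over Mathlib's `ℤ_[p]`; nothing here is specific to the disputed corpus.

* `IwU p` — the group `U = 1 + pℤ_p` in the additive coordinate `s ↔ 1 + p s`: carrier `ℤ_p`, law
  `s ∗ t = s + t + p s t`; a compact, Hausdorff, totally disconnected topological group.
* `Iw p` — the group `P = ℤ_p ⋊ U` ("pro-`p` Iwahori-type"), coordinates `(a, s)`, law
  `(a, s)(b, t) = (a + (1 + p s) b, s ∗ t)`; compact, Hausdorff, totally disconnected topological group.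
* `Iw.bHom c : IwU p →ₜ* Iw p`, `s ↦ (c s, s)` — for `c : ℤ_p` the complement `T_c` of the translation
  subgroup (`T_0` the torus, `T_1` a twisted complement; `H¹(U, ℤ_p) = ℤ_p/p ≠ 0`); injective.
* `Iw.mem_range_bHom_iff`, `Iw.conj_mem_range_bHom` (`x T_{c'} x⁻¹ ⊆ T_{(1+p x.s) c' − p x.a}`),
  `Iw.range_bHom_inf_eq_bot` (`T_c ⊓ T_d = ⊥` for `c ≠ d`), whence the ESTRANGEMENT lemmas
  `Iw.range_bHom_inf_conj_eq_bot_of_ne` (different `c, c' ∈ {0, 1}`, every conjugator) and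
  `Iw.range_bHom_inf_conj_eq_bot_of_not_mem` (same `c`, conjugator outside `T_c`: malnormality), the
  infinitude `Iw.infinite_range_bHom` and `Iw.isSlimGroup` (every open subgroup has trivial centraliser).

[cite: MochizukiSemiAnbd2006, Def 2.4 p.25-26]
-/

noncomputable section

open Topology

namespace Literature.AnabelianGeometry.SemiGraphs

variable (p : ℕ) [Fact p.Prime]

/-! ## 1. Units `1 + p s` of `ℤ_p` -/

namespace IwahoriWitness

/-- `w s := 1 + p s ∈ ℤ_p`. [cite: MochizukiSemiAnbd2006, §2 p.23] -/
def w (s : ℤ_[p]) : ℤ_[p] := 1 + (p : ℤ_[p]) * s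

/-- `‖p s‖ < 1`. [cite: MochizukiSemiAnbd2006, §2 p.23] -/
theorem norm_p_mul_lt_one (s : ℤ_[p]) : ‖(p : ℤ_[p]) * s‖ < 1 := by
  have hp : (1 : ℝ) < p := by exact_mod_cast (Fact.out : p.Prime).one_lt
  calc ‖(p : ℤ_[p]) * s‖ = ‖(p : ℤ_[p])‖ * ‖s‖ := norm_mul _ _
    _ ≤ (p : ℝ)⁻¹ * 1 := by
        rw [PadicInt.norm_p]
        exact mul_le_mul_of_nonneg_left (PadicInt.norm_le_one s) (by positivity)
    _ < 1 := by rw [mul_one]; exact inv_lt_one_of_one_lt₀ hp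

/-- `1 + p s` is a unit of `ℤ_p`. [cite: MochizukiSemiAnbd2006, §2 p.23] -/
theorem isUnit_w (s : ℤ_[p]) : IsUnit (w p s) := by
  have h := (Units.oneSub (-((p : ℤ_[p]) * s)) (by rw [norm_neg]; exact norm_p_mul_lt_one p s)).isUnit
  simpa [w, Units.oneSub, sub_neg_eq_add] using h

/-- `winv s := (1 + p s)⁻¹ ∈ ℤ_p`. [cite: MochizukiSemiAnbd2006, §2 p.23] -/
def winv (s : ℤ_[p]) : ℤ_[p] := Ring.inverse (w p s)

/-- `(1 + p s)⁻¹ (1 + p s) = 1`. [cite: MochizukiSemiAnbd2006, §2 p.23] -/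
@[simp] theorem winv_mul_w (s : ℤ_[p]) : winv p s * w p s = 1 := Ring.inverse_mul_cancel _ (isUnit_w p s)

/-- `(1 + p s) (1 + p s)⁻¹ = 1`. [cite: MochizukiSemiAnbd2006, §2 p.23] -/
@[simp] theorem w_mul_winv (s : ℤ_[p]) : w p s * winv p s = 1 := Ring.mul_inverse_cancel _ (isUnit_w p s)

/-- `s ↦ (1 + p s)⁻¹` is continuous. [cite: MochizukiSemiAnbd2006, §2 p.23] -/
theorem continuous_winv : Continuous (winv p) := by
  refine continuous_iff_continuousAt.2 fun s => ?_
  have hc : ContinuousAt Ring.inverse (w p s) := by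
    obtain ⟨u, hu⟩ := isUnit_w p s
    rw [← hu]
    exact NormedRing.inverse_continuousAt u
  exact hc.comp (by unfold w; fun_prop)

/-- `(1 + p s)(1 + p t) = 1 + p (s + t + p s t)`. [cite: MochizukiSemiAnbd2006, §2 p.23] -/
theorem w_mul_w (s t : ℤ_[p]) : w p s * w p t = w p (s + t + (p : ℤ_[p]) * s * t) := by
  unfold w; ring

end IwahoriWitness

open IwahoriWitness

/-! ## 2. The group `U = 1 + pℤ_p` in the additive coordinate -/

/-- The group `U = 1 + pℤ_p` written in the coordinate `s ↔ 1 + p s`. [cite: MochizukiSemiAnbd2006, §2 p.23] -/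
@[ext] structure IwU (p : ℕ) [Fact p.Prime] : Type where
  /-- the coordinate `s` of `1 + p s` -/
  s : ℤ_[p]

namespace IwU

variable {p}

/-- Structure instance of the witness group (`U`). [cite: MochizukiSemiAnbd2006, §2 p.23] -/
instance : Mul (IwU p) := ⟨fun x y => ⟨x.s + y.s + (p : ℤ_[p]) * x.s * y.s⟩⟩
/-- Structure instance of the witness group (`U`). [cite: MochizukiSemiAnbd2006, §2 p.23] -/
instance : One (IwU p) := ⟨⟨0⟩⟩
/-- Structure instance of the witness group (`U`). [cite: MochizukiSemiAnbd2006, §2 p.23] -/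
instance : Inv (IwU p) := ⟨fun x => ⟨-x.s * winv p x.s⟩⟩

/-- Coordinate of a product. [cite: MochizukiSemiAnbd2006, §2 p.23] -/
@[simp] theorem mul_s (x y : IwU p) : (x * y).s = x.s + y.s + (p : ℤ_[p]) * x.s * y.s := rfl
/-- Coordinate of the identity. [cite: MochizukiSemiAnbd2006, §2 p.23] -/
@[simp] theorem one_s : (1 : IwU p).s = 0 := rfl
/-- Coordinate of an inverse. [cite: MochizukiSemiAnbd2006, §2 p.23] -/
@[simp] theorem inv_s (x : IwU p) : x⁻¹.s = -x.s * winv p x.s := rfl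

/-- `w` of a product is the product of the `w`'s. [cite: MochizukiSemiAnbd2006, §2 p.23] -/
theorem w_mul (x y : IwU p) : w p (x * y).s = w p x.s * w p y.s := by
  rw [mul_s, w_mul_w]

/-- `U` is a group. [cite: MochizukiSemiAnbd2006, §2 p.23] -/
instance : Group (IwU p) where
  mul_assoc x y z := by ext; simp only [mul_s]; ring
  one_mul x := by ext; simp
  mul_one x := by ext; simp
  inv_mul_cancel x := by
    ext
    simp only [mul_s, inv_s, one_s]
    have h := winv_mul_w p x.s
    unfold w at h
    linear_combination (-x.s) * h

/-- The coordinate map `U → ℤ_p`. [cite: MochizukiSemiAnbd2006, §2 p.23] -/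
def equivZp : IwU p ≃ ℤ_[p] := ⟨fun x => x.s, fun s => ⟨s⟩, fun _ => rfl, fun _ => rfl⟩

/-- Structure instance of the witness group (`U`). [cite: MochizukiSemiAnbd2006, §2 p.23] -/
instance : TopologicalSpace (IwU p) := TopologicalSpace.induced (fun x => x.s) inferInstance

/-- The coordinate map is a homeomorphism. [cite: MochizukiSemiAnbd2006, §2 p.23] -/
def homeoZp : IwU p ≃ₜ ℤ_[p] := (equivZp (p := p)).toHomeomorphOfIsInducing ⟨rfl⟩

/-- `x ↦ x.s` is continuous. [cite: MochizukiSemiAnbd2006, §2 p.23] -/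
theorem continuous_s : Continuous fun x : IwU p => x.s := (homeoZp (p := p)).continuous

/-- A map into `U` is continuous iff its coordinate is. [cite: MochizukiSemiAnbd2006, §2 p.23] -/
theorem continuous_mk_iff {X : Type*} [TopologicalSpace X] {f : X → ℤ_[p]} :
    Continuous (fun x => (⟨f x⟩ : IwU p)) ↔ Continuous f :=
  ⟨fun h => (continuous_s (p := p)).comp h, fun h => (homeoZp (p := p)).symm.continuous.comp h⟩

/-- Structure instance of the witness group (`U`). [cite: MochizukiSemiAnbd2006, §2 p.23] -/
instance : CompactSpace (IwU p) := (homeoZp (p := p)).symm.compactSpace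
/-- Structure instance of the witness group (`U`). [cite: MochizukiSemiAnbd2006, §2 p.23] -/
instance : T2Space (IwU p) := (homeoZp (p := p)).symm.t2Space
/-- Structure instance of the witness group (`U`). [cite: MochizukiSemiAnbd2006, §2 p.23] -/
instance : TotallyDisconnectedSpace (IwU p) := (homeoZp (p := p)).symm.totallyDisconnectedSpace

/-- `U` is a topological group. [cite: MochizukiSemiAnbd2006, §2 p.23] -/
instance : IsTopologicalGroup (IwU p) where
  continuous_mul := by
    apply (continuous_mk_iff (p := p)).2
    have h1 : Continuous fun q : IwU p × IwU p => q.1.s := continuous_s.comp continuous_fst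
    have h2 : Continuous fun q : IwU p × IwU p => q.2.s := continuous_s.comp continuous_snd
    fun_prop
  continuous_inv := by
    apply (continuous_mk_iff (p := p)).2
    exact (continuous_s.neg).mul ((continuous_winv p).comp continuous_s)

/-- `U ≅ ℤ_p` is infinite. [cite: MochizukiSemiAnbd2006, §2 p.23] -/
instance : Infinite (IwU p) :=
  haveI : Infinite ℤ_[p] := Infinite.of_injective (Nat.cast : ℕ → ℤ_[p]) Nat.cast_injective
  Infinite.of_injective (fun s : ℤ_[p] => (⟨s⟩ : IwU p)) fun _ _ h => by simpa using congrArg IwU.s h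

end IwU

/-! ## 3. The group `P = ℤ_p ⋊ U` -/

/-- The group `P = ℤ_p ⋊ (1 + pℤ_p)` in coordinates `(a, s)`, `u = 1 + p s` acting on `a ∈ ℤ_p` by
multiplication. [cite: MochizukiSemiAnbd2006, §2 p.23] -/
@[ext] structure Iw (p : ℕ) [Fact p.Prime] : Type where
  /-- the translation coordinate -/
  a : ℤ_[p]
  /-- the unit coordinate (`u = 1 + p s`) -/
  s : ℤ_[p]

namespace Iw

variable {p}

/-- Structure instance of the witness group (`P`). [cite: MochizukiSemiAnbd2006, §2 p.23] -/
instance : Mul (Iw p) := ⟨fun x y => ⟨x.a + w p x.s * y.a, x.s + y.s + (p : ℤ_[p]) * x.s * y.s⟩⟩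
/-- Structure instance of the witness group (`P`). [cite: MochizukiSemiAnbd2006, §2 p.23] -/
instance : One (Iw p) := ⟨⟨0, 0⟩⟩
/-- Structure instance of the witness group (`P`). [cite: MochizukiSemiAnbd2006, §2 p.23] -/
instance : Inv (Iw p) := ⟨fun x => ⟨-(winv p x.s * x.a), -x.s * winv p x.s⟩⟩

/-- Coordinates of a product. [cite: MochizukiSemiAnbd2006, §2 p.23] -/
@[simp] theorem mul_a (x y : Iw p) : (x * y).a = x.a + w p x.s * y.a := rfl
/-- Coordinates of a product. [cite: MochizukiSemiAnbd2006, §2 p.23] -/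
@[simp] theorem mul_s (x y : Iw p) : (x * y).s = x.s + y.s + (p : ℤ_[p]) * x.s * y.s := rfl
/-- Coordinates of the identity. [cite: MochizukiSemiAnbd2006, §2 p.23] -/
@[simp] theorem one_a : (1 : Iw p).a = 0 := rfl
/-- Coordinates of the identity. [cite: MochizukiSemiAnbd2006, §2 p.23] -/
@[simp] theorem one_s : (1 : Iw p).s = 0 := rfl
/-- Coordinates of an inverse. [cite: MochizukiSemiAnbd2006, §2 p.23] -/
@[simp] theorem inv_a (x : Iw p) : x⁻¹.a = -(winv p x.s * x.a) := rfl
/-- Coordinates of an inverse. [cite: MochizukiSemiAnbd2006, §2 p.23] -/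
@[simp] theorem inv_s (x : Iw p) : x⁻¹.s = -x.s * winv p x.s := rfl

/-- `P` is a group. [cite: MochizukiSemiAnbd2006, §2 p.23] -/
instance : Group (Iw p) where
  mul_assoc x y z := by
    ext
    · simp only [mul_a, mul_s]
      have h := w_mul_w p x.s y.s
      rw [show x.s + y.s + (p : ℤ_[p]) * x.s * y.s = x.s + y.s + (p : ℤ_[p]) * x.s * y.s from rfl] at h
      rw [← h]; ring
    · simp only [mul_s]; ring
  one_mul x := by ext <;> simp [w]
  mul_one x := by ext <;> simp
  inv_mul_cancel x := by
    ext
    · simp only [mul_a, inv_a, inv_s, one_a]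
      have h := winv_mul_w p x.s
      unfold w at h ⊢
      linear_combination (-x.a) * h
    · simp only [mul_s, inv_s, one_s]
      have h := winv_mul_w p x.s
      unfold w at h
      linear_combination (-x.s) * h

/-- `w` of the unit coordinate is multiplicative. [cite: MochizukiSemiAnbd2006, §2 p.23] -/
theorem w_mul (x y : Iw p) : w p (x * y).s = w p x.s * w p y.s := by rw [mul_s, w_mul_w]

/-- The coordinate map `P → ℤ_p × ℤ_p`. [cite: MochizukiSemiAnbd2006, §2 p.23] -/
def equivProd : Iw p ≃ ℤ_[p] × ℤ_[p] :=
  ⟨fun x => (x.a, x.s), fun q => ⟨q.1, q.2⟩, fun _ => rfl, fun _ => rfl⟩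

/-- Structure instance of the witness group (`P`). [cite: MochizukiSemiAnbd2006, §2 p.23] -/
instance : TopologicalSpace (Iw p) := TopologicalSpace.induced (fun x => (x.a, x.s)) inferInstance

/-- The coordinate map is a homeomorphism. [cite: MochizukiSemiAnbd2006, §2 p.23] -/
def homeoProd : Iw p ≃ₜ ℤ_[p] × ℤ_[p] := (equivProd (p := p)).toHomeomorphOfIsInducing ⟨rfl⟩

/-- `x ↦ x.a` is continuous. [cite: MochizukiSemiAnbd2006, §2 p.23] -/
theorem continuous_a : Continuous fun x : Iw p => x.a := continuous_fst.comp (homeoProd (p := p)).continuous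
/-- `x ↦ x.s` is continuous. [cite: MochizukiSemiAnbd2006, §2 p.23] -/
theorem continuous_s : Continuous fun x : Iw p => x.s := continuous_snd.comp (homeoProd (p := p)).continuous

/-- A map into `P` is continuous iff its two coordinates are. [cite: MochizukiSemiAnbd2006, §2 p.23] -/
theorem continuous_mk_iff {X : Type*} [TopologicalSpace X] {f g : X → ℤ_[p]} :
    Continuous (fun x => (⟨f x, g x⟩ : Iw p)) ↔ Continuous f ∧ Continuous g :=
  ⟨fun h => ⟨(continuous_a (p := p)).comp h, (continuous_s (p := p)).comp h⟩,
    fun h => (homeoProd (p := p)).symm.continuous.comp (h.1.prodMk h.2)⟩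

/-- Structure instance of the witness group (`P`). [cite: MochizukiSemiAnbd2006, §2 p.23] -/
instance : CompactSpace (Iw p) := (homeoProd (p := p)).symm.compactSpace
/-- Structure instance of the witness group (`P`). [cite: MochizukiSemiAnbd2006, §2 p.23] -/
instance : T2Space (Iw p) := (homeoProd (p := p)).symm.t2Space
/-- Structure instance of the witness group (`P`). [cite: MochizukiSemiAnbd2006, §2 p.23] -/
instance : TotallyDisconnectedSpace (Iw p) := (homeoProd (p := p)).symm.totallyDisconnectedSpace

/-- `P` is a topological group. [cite: MochizukiSemiAnbd2006, §2 p.23] -/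
instance : IsTopologicalGroup (Iw p) where
  continuous_mul := by
    have h1a : Continuous fun q : Iw p × Iw p => q.1.a := continuous_a.comp continuous_fst
    have h1s : Continuous fun q : Iw p × Iw p => q.1.s := continuous_s.comp continuous_fst
    have h2a : Continuous fun q : Iw p × Iw p => q.2.a := continuous_a.comp continuous_snd
    have h2s : Continuous fun q : Iw p × Iw p => q.2.s := continuous_s.comp continuous_snd
    have hw : Continuous fun q : Iw p × Iw p => w p q.1.s := by unfold w; fun_prop
    exact (continuous_mk_iff (p := p)).2 ⟨by fun_prop, by fun_prop⟩
  continuous_inv := by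
    have hwi : Continuous fun x : Iw p => winv p x.s := (continuous_winv p).comp continuous_s
    exact (continuous_mk_iff (p := p)).2
      ⟨(hwi.mul continuous_a).neg, continuous_s.neg.mul hwi⟩

/-! ## 4. The complements `T_c` -/

/-- `b_c : U → P`, `s ↦ (c s, s)` — the complement `T_c` of the translation subgroup, as a continuous
homomorphism (`c = 0`: the torus; `c = 1`: a twisted complement). [cite: MochizukiSemiAnbd2006, Def 2.1 p.22] -/
def bHom (c : ℤ_[p]) : IwU p →ₜ* Iw p where
  toFun x := ⟨c * x.s, x.s⟩
  map_one' := by ext <;> simp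
  map_mul' x y := by
    ext
    · simp only [IwU.mul_s, mul_a, w]; ring
    · simp only [IwU.mul_s, mul_s]
  continuous_toFun := (continuous_mk_iff (p := p)).2 ⟨continuous_const.mul IwU.continuous_s, IwU.continuous_s⟩

/-- Coordinates of `b_c`. [cite: MochizukiSemiAnbd2006, §2 p.23] -/
@[simp] theorem bHom_a (c : ℤ_[p]) (x : IwU p) : (bHom c x).a = c * x.s := rfl
/-- Coordinates of `b_c`. [cite: MochizukiSemiAnbd2006, §2 p.23] -/
@[simp] theorem bHom_s (c : ℤ_[p]) (x : IwU p) : (bHom c x).s = x.s := rfl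

/-- `b_c` is injective. [cite: MochizukiSemiAnbd2006, Def 2.1 p.22] -/
theorem bHom_injective (c : ℤ_[p]) : Function.Injective (bHom c) := fun x y h => by
  ext; simpa using congrArg Iw.s h

/-- `T_c` is the graph `{(c s, s)}`: membership in the range of `b_c`. [cite: MochizukiSemiAnbd2006, Def 2.1 p.22] -/
theorem mem_range_bHom_iff (c : ℤ_[p]) (x : Iw p) :
    x ∈ (bHom c).toMonoidHom.range ↔ x.a = c * x.s := by
  constructor
  · rintro ⟨y, rfl⟩; rfl
  · intro h; exact ⟨⟨x.s⟩, by ext <;> simp [h]⟩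

/-- The conjugation formula of `P`: `(x y x⁻¹).s = y.s` and `(x y x⁻¹).a = −p y.s x.a + (1 + p x.s) y.a`.
[cite: MochizukiSemiAnbd2006, Def 2.4(iv) p.26] -/
theorem conj_coords (x y : Iw p) :
    (x * y * x⁻¹).s = y.s ∧ (x * y * x⁻¹).a = -((p : ℤ_[p]) * y.s * x.a) + w p x.s * y.a := by
  have hxs := winv_mul_w p x.s
  have hmul : w p (x * y).s = w p x.s * w p y.s := w_mul x y
  constructor
  · simp only [mul_s, inv_s]
    unfold w at hxs
    linear_combination (-(x.s * (1 + (p:ℤ_[p]) * y.s))) * hxs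
  · simp only [mul_a, inv_a]
    rw [hmul]
    unfold w at hxs ⊢
    linear_combination (-(1 + (p:ℤ_[p]) * y.s) * x.a) * hxs

/-- Conjugation carries `T_{c'}` into `T_{(1 + p x.s) c' − p x.a}`. [cite: MochizukiSemiAnbd2006, Def 2.4(iv) p.26] -/
theorem conj_mem_range_bHom (c' : ℤ_[p]) (x y : Iw p) (hy : y ∈ (bHom c').toMonoidHom.range) :
    x * y * x⁻¹ ∈ (bHom (w p x.s * c' - (p : ℤ_[p]) * x.a)).toMonoidHom.range := by
  rw [mem_range_bHom_iff] at hy ⊢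
  obtain ⟨hs, ha⟩ := conj_coords x y
  rw [hs, ha, hy]
  ring

/-- `T_c ∩ T_d = 1` for `c ≠ d`. [cite: MochizukiSemiAnbd2006, Def 2.4(iv) p.26] -/
theorem eq_one_of_mem_range_bHom_of_mem {c d : ℤ_[p]} (hcd : c ≠ d) {x : Iw p}
    (hc : x ∈ (bHom c).toMonoidHom.range) (hd : x ∈ (bHom d).toMonoidHom.range) : x = 1 := by
  rw [mem_range_bHom_iff] at hc hd
  have hs : (c - d) * x.s = 0 := by rw [sub_mul, ← hc, ← hd, sub_self]
  have hs' : x.s = 0 := by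
    rcases mul_eq_zero.1 hs with h | h
    · exact absurd (sub_eq_zero.1 h) hcd
    · exact h
  ext
  · rw [hc, hs', mul_zero]; rfl
  · exact hs'

/-- `p ≠ 0` in `ℤ_p`. [cite: MochizukiSemiAnbd2006, §2 p.23] -/
theorem p_ne_zero : (p : ℤ_[p]) ≠ 0 := by exact_mod_cast (Fact.out : p.Prime).ne_zero

/-- `1 ≠ p z` in `ℤ_p`. [cite: MochizukiSemiAnbd2006, §2 p.23] -/
theorem one_ne_p_mul (z : ℤ_[p]) : (1 : ℤ_[p]) ≠ (p : ℤ_[p]) * z := by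
  intro h
  have h1 : ‖(1 : ℤ_[p])‖ < 1 := by rw [h]; exact norm_p_mul_lt_one p z
  simp at h1

/-- **Estrangement of the two branches**: for `{c, c'} = {0, 1}` and EVERY `x ∈ P`,
`T_c ∩ x T_{c'} x⁻¹ = 1`. [cite: MochizukiSemiAnbd2006, Def 2.4(iv) p.26] -/
theorem range_bHom_inf_conj_eq_bot_of_ne {c c' : ℤ_[p]} (h : (c = 0 ∧ c' = 1) ∨ (c = 1 ∧ c' = 0))
    (x : Iw p) :
    (bHom c).toMonoidHom.range ⊓ ((bHom c').toMonoidHom.range.map (MulAut.conj x).toMonoidHom) = ⊥ := by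
  rw [eq_bot_iff]
  rintro z ⟨hz, ⟨y, hy, rfl⟩⟩
  rw [Subgroup.mem_bot]
  have hy' := conj_mem_range_bHom c' x y hy
  refine eq_one_of_mem_range_bHom_of_mem ?_ hz hy'
  rcases h with ⟨rfl, rfl⟩ | ⟨rfl, rfl⟩
  · rw [mul_one]
    intro h0
    apply one_ne_p_mul (p := p) (x.a - x.s)
    unfold w at h0
    linear_combination -h0
  · rw [mul_zero, zero_sub]
    intro h1
    apply one_ne_p_mul (p := p) (-x.a)
    linear_combination h1

/-- **Malnormality**: for `x ∉ T_c`, `T_c ∩ x T_c x⁻¹ = 1`. [cite: MochizukiSemiAnbd2006, Def 2.4(iv) p.26] -/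
theorem range_bHom_inf_conj_eq_bot_of_not_mem (c : ℤ_[p]) {x : Iw p}
    (hx : x ∉ (bHom c).toMonoidHom.range) :
    (bHom c).toMonoidHom.range ⊓ ((bHom c).toMonoidHom.range.map (MulAut.conj x).toMonoidHom) = ⊥ := by
  rw [eq_bot_iff]
  rintro z ⟨hz, ⟨y, hy, rfl⟩⟩
  rw [Subgroup.mem_bot]
  refine eq_one_of_mem_range_bHom_of_mem ?_ hz (conj_mem_range_bHom c x y hy)
  intro h
  apply hx
  rw [mem_range_bHom_iff]
  have h' : (p : ℤ_[p]) * (x.a - c * x.s) = 0 := by unfold w at h; linear_combination h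
  rcases mul_eq_zero.1 h' with h0 | h0
  · exact absurd h0 p_ne_zero
  · exact sub_eq_zero.1 h0

/-- `T_c ≅ U` is infinite. [cite: MochizukiSemiAnbd2006, Def 2.4(iv) p.26] -/
theorem infinite_range_bHom (c : ℤ_[p]) : Infinite (bHom (p := p) c).toMonoidHom.range :=
  Infinite.of_injective (fun y : IwU p => ⟨bHom c y, y, rfl⟩) fun _ _ h =>
    bHom_injective c (congrArg Subtype.val h)

/-- A subgroup meeting `T_c` trivially has relative index `0` (= infinite index) in it. [cite: MochizukiSemiAnbd2006, Def 2.4(iv) p.26] -/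
theorem relIndex_eq_zero_of_inf_eq_bot (c : ℤ_[p]) {H : Subgroup (Iw p)}
    (h : (bHom c).toMonoidHom.range ⊓ H = ⊥) : H.relIndex (bHom c).toMonoidHom.range = 0 := by
  haveI := infinite_range_bHom (p := p) c
  rw [Subgroup.relIndex, show H.subgroupOf (bHom c).toMonoidHom.range = ⊥ from ?_, Subgroup.index_bot]
  · exact Nat.card_eq_zero_of_infinite
  · rw [eq_bot_iff]
    intro z hz
    rw [Subgroup.mem_bot]
    have : (z : Iw p) ∈ (bHom c).toMonoidHom.range ⊓ H := ⟨z.2, hz⟩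
    rw [h, Subgroup.mem_bot] at this
    exact Subtype.ext this

/-! ## 5. Slimness of `P` -/

/-- An open subgroup of `P` contains `(p^n, 0)` and `(0, p^n)` for some `n`. [cite: MochizukiSemiAnbd2006, Def 2.4(ii) p.25] -/
theorem exists_pow_mem_of_isOpen (H : Subgroup (Iw p)) (hH : IsOpen (H : Set (Iw p))) :
    ∃ n : ℕ, (⟨(p : ℤ_[p]) ^ n, 0⟩ : Iw p) ∈ H ∧ (⟨0, (p : ℤ_[p]) ^ n⟩ : Iw p) ∈ H := by
  have h1 : (H : Set (Iw p)) ∈ 𝓝 (1 : Iw p) := hH.mem_nhds H.one_mem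
  have hcont : Continuous fun q : ℤ_[p] × ℤ_[p] => (⟨q.1, q.2⟩ : Iw p) :=
    (continuous_mk_iff (p := p)).2 ⟨continuous_fst, continuous_snd⟩
  have h2 : (fun q : ℤ_[p] × ℤ_[p] => (⟨q.1, q.2⟩ : Iw p)) ⁻¹' (H : Set (Iw p)) ∈ 𝓝 ((0 : ℤ_[p]), (0 : ℤ_[p])) :=
    hcont.continuousAt.preimage_mem_nhds (by exact h1)
  rw [Metric.mem_nhds_iff] at h2
  obtain ⟨ε, hε, hball⟩ := h2
  have hp : (1 : ℝ) < p := by exact_mod_cast (Fact.out : p.Prime).one_lt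
  obtain ⟨n, hn⟩ := exists_pow_lt_of_lt_one hε (inv_lt_one_of_one_lt₀ hp)
  have hnorm : ‖(p : ℤ_[p]) ^ n‖ < ε := by
    rw [PadicInt.norm_p_pow, zpow_neg, zpow_natCast, ← inv_pow]; exact hn
  have m1 : (((p : ℤ_[p]) ^ n, (0 : ℤ_[p])) : ℤ_[p] × ℤ_[p]) ∈ Metric.ball ((0 : ℤ_[p]), (0 : ℤ_[p])) ε := by
    rw [Metric.mem_ball, Prod.dist_eq, dist_zero_right, dist_self, max_eq_left (norm_nonneg _)]
    exact hnorm
  have m2 : (((0 : ℤ_[p]), (p : ℤ_[p]) ^ n) : ℤ_[p] × ℤ_[p]) ∈ Metric.ball ((0 : ℤ_[p]), (0 : ℤ_[p])) ε := by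
    rw [Metric.mem_ball, Prod.dist_eq, dist_self, dist_zero_right, max_eq_right (norm_nonneg _)]
    exact hnorm
  exact ⟨n, hball m1, hball m2⟩

/-- **`P` is slim**: the centraliser of every open subgroup is trivial (`Z_P((p^n,0)) ∩ Z_P((0,p^n)) = 1`).
[cite: MochizukiSemiAnbd2006, Def 2.4(ii) p.25] -/
theorem centralizer_eq_bot_of_isOpen (H : Subgroup (Iw p)) (hH : IsOpen (H : Set (Iw p))) :
    Subgroup.centralizer (H : Set (Iw p)) = ⊥ := by
  obtain ⟨n, hn1, hn2⟩ := exists_pow_mem_of_isOpen H hH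
  rw [eq_bot_iff]
  intro z hz
  rw [Subgroup.mem_centralizer_iff] at hz
  rw [Subgroup.mem_bot]
  have hpn : ((p : ℤ_[p]) ^ n) ≠ 0 := pow_ne_zero _ p_ne_zero
  -- commuting with `(p^n, 0)` forces `z.s = 0`
  have e1 := hz _ hn1
  have hs : z.s = 0 := by
    have ha := congrArg Iw.a e1
    simp only [mul_a, w, mul_zero, add_zero] at ha
    -- ha : p^n + (1 + p*0) * z.a = z.a + (1 + p * z.s) * p^n
    have : (p : ℤ_[p]) * z.s * (p : ℤ_[p]) ^ n = 0 := by linear_combination -ha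
    rcases mul_eq_zero.1 this with h | h
    · rcases mul_eq_zero.1 h with h' | h'
      · exact absurd h' p_ne_zero
      · exact h'
    · exact absurd h hpn
  -- commuting with `(0, p^n)` forces `z.a = 0`
  have e2 := hz _ hn2
  have ha : z.a = 0 := by
    have ha' := congrArg Iw.a e2
    simp only [mul_a, w, hs, mul_zero, add_zero, zero_add] at ha'
    -- ha' : (1 + p * p^n) * z.a = z.a
    have : (p : ℤ_[p]) * (p : ℤ_[p]) ^ n * z.a = 0 := by linear_combination ha'
    rcases mul_eq_zero.1 this with h | h
    · rcases mul_eq_zero.1 h with h' | h'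
      · exact absurd h' p_ne_zero
      · exact absurd h' hpn
    · exact h
  ext
  · rw [ha]; rfl
  · rw [hs]; rfl

end Iw

end Literature.AnabelianGeometry.SemiGraphs

end
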